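import Mathlib
import HarnessLib
import HarnessLib.Audit
import Summits.KontsevichZagierPeriods.Statement
import Literature.NumberTheory.Transcendental.KZMoveFamily
import Summits.KontsevichZagierPeriods.KontsevichZagierPeriods.Theorems.GaussManinCertificatesKZStokesBox

/-!
Route: KatzTower

DORMANT since 2026-09-04T21:46:34Z (reconciler: no traction for 5 d (last activity item-evidence-added at 2026-08-30T20:47:30Z); parked, not closed — `ledger route dormant route-KontsevichZagierPeriods-KatzTower --off` to reactivate) — unstaffed, not closed; items shared with open routes are served there. `ledger route dormant <id> --off` reactivates.

# Route KatzTower — Katz's middle-convolution tower as moves — rigid identities are Beta monomials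
up to π-torsion

It suffices to show X = BetaLocalKernel ∧ BetaWall ∧ PiCancellation (card
katz-tower-rigidity-is-a-move). BetaLocalKernel (TARGET):
Conjecture 1 in kernel form, LOCALISED at [π] and taken MODULO THE BETA-MONOMIAL IDENTITIES — every
c with eval c = 0 has [π]^N·c in the
subgroup generated by the four moves together with all differences [β] − [β′] of equal-valued Beta
boxes (products of 1-dimensional
representations C·x^p(1−x)^q on (0,1), p, q rational, C real algebraic). BetaWall (the Γ-WALL,
shared with route Neg): every such Beta-box
identity is itself derivable. PiCancellation ([π] is a non-zero-divisor modulo the moves; the tree's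
open statement KZ.PiCancellation, item
0540 of AyoubSpecialisation). The card's mechanism — Katz's algorithm run INSIDE the rules (inverse
Euler step = differentiate the
integrand, then J^(1−λ); rank descent to rank one; Oshima's Γ-ratios at the anchors) — is the
constructive attack on BetaLocalKernel over
the whole rigid (accessory-parameter-free) sector, where it proves [π]^N([E₁(x₀)] − κ[E₂(x₀)]) ∈
⟨moves, Beta boxes⟩; ClausenQuarterModPi
is its first typed cross-family instance (no Γ at all: κ = 2).
Lean: `BetaLocalKernel ∧ BetaWall ∧ PiCancellation`

## Assembly
Pure algebra, proved sorry-free as `closes` (axioms propext, Classical.choice, Quot.sound). Since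
rev 1 the [π]-multiplication is written
in the import-free P-FORM of route AyoubSpecialisation (items 0540/0541): P n r : IntegralRep (n+2)
is the representation [π]·[r] PINNED by its
domain {z | z 0² + z 1² ≤ 1 ∧ (z 2, …) ∈ r.domain} and integrand r.integrand ∘ tail (unique once it
exists), and "[π]·" on FormalRep is
FreeAbelianGroup.lift (s ↦ [P s]); the support item DiscPadding is the CONSTRUCTION statement (such
a P exists; provable now). Proof: given
rational r, r′ with equal values, c = [r] − [r′] has eval c = 0 (map_sub, eval_of); DiscPadding
gives P; BetaLocalKernel (at P) gives N with
[π]^N·c ∈ relations ⊔ closure(Beta-box differences); BetaWall puts every generator of the second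
summand in relations (AddSubgroup.closure_le,
sup_le), so [π]^N·c ∈ relations; PiCancellation (at P) N times (Function.iterate_succ_apply') gives
c ∈ relations, i.e. KZ.Equivalent r r′.
The other items are the mechanism attacking BetaLocalKernel on the rigid sector and do not enter the
deciding theorem. (Rev 1, cone repair:
the route file no longer imports KZProduct, whose open Props PiCancellation/PiLocalKernel are
conjectures, not dischargeable facts; it imports
KZMoveFamily for FibrewiseIntegration.)

Rationale: WHY THIS LINE. Katz–Oshima theory (Katz1996 Ch. 5–6; Haraoka2020 Thm 7.22–7.23, Thm 6.2; Oshima2012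
Ch. 12; DettweilerReiter2010) says that every
irreducible rigid Fuchsian system descends to rank one by additions and middle convolutions, that
its solutions are iterated Euler
integrals, and that its connection coefficients are Γ-ratios; analytically the middle convolution is
the Riemann–Liouville transform,
whose semigroup law is Fubini plus the substitution u = (t−s)/(x−s) (Haraoka2020 proof of Thm 7.4,
read on PDF p. 132) — a KZ change of
variables in which the powers of (x−s) cancel exactly — and whose inverse needs no limit: J^λ
J^(1−λ) ∂ₓG = B(λ,1−λ)(G(x) − G(a)) for ANY
pencil G, one parameter-direction Newton–Leibniz whose primitive is the integrand itself (support
TowerStep; the catalogued primitive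
barrier is structurally absent). Planning analysis beyond the card: linearity already forces the
descended pencils to agree; what rank
one buys is ALGEBRAIC parameter dependence (h = Π(s−aⱼ)^αⱼ, rational exponents), so uniform flat
transport turns each bottom pencil into
(algebraic function) × (constant representation), the Euler transform of that is the canonical Katz
representation TENSOR the constant
(KZProduct; products commute modulo relations, KZProductIdeal, proved), and the residue of any rigid
identity is exactly (i) the Beta
spectators Π B(λᵢ,1−λᵢ) that every inverse step produces — [B(½,½)] ~ [π] — whence π-LOCALISATION is
intrinsic and KZ.PiCancellation is
load-bearing, and (ii) one Beta-monomial identity between Oshima constants — the Γ-wall, isolated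
rather than hit. Imported: Katz–Oshima
middle-convolution theory and fractional calculus (complex ODE), twisted-period bookkeeping
(Aomoto–Kita), the hub's product and family
calculi. No prior route changes the RANK of a period pencil: CubicTransport/two-route transport stay
inside one ₂F₁ family,
GaussManinCertificates pairs one class with a cyclic family, RamanujanComposites routes Clausen
through the Shioda–Inose correspondence,
AyoubSpecialisation is non-constructive; the negatives index (1 entry, KinematicFormulas convexity)
is not touched.

RANKED CRUXES. #0 BetaLocalKernel (target) — Conjecture 1 localised at [π] and modulo Beta-monomial
identities: for every formal combination c with KZ.eval c = 0 there is N with ([π]·)^[N] c in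
KZ.relations ⊔ closure{of β − of β′ : β, β′ Beta boxes (domain (0,1)^k, integrand C·Πᵢ
xᵢ^pᵢ(1−xᵢ)^qᵢ, p, q ∈ ℚ, C real algebraic) with β.value = β′.value}. Stated in the P-form of
AyoubSpecialisation 0541 ([π]· = FreeAbelianGroup.lift (s ↦ [P s]) for the pinned padding operator
P, quantified ∀P; existence = support DiscPadding): literally 0541's statement with the Beta closure
joined, so PiLocalKernel (0541) and KZKernelConjecture imply it; the rigid sector of it is what the
tower proves (informal crux RigidSectorModBeta, filed after open). (why it might fail: It is
Conjecture 1 up to π-torsion and Γ-values (GPC strength): false iff some vanishing combination is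
missed by moves + Beta identities even after ×[π]^N — Neg's pressure points (a) regularised MZV
relations and (c) transcendental primitives are untouched by the tower.) [KontsevichZagier2001,
HuberMullerStach2017, Ayoub2014, Haraoka2020, Oshima2012]
#2 ClausenQuarterModPi (crux) — Clausen 1828 at a = b = 1/4, ₂F₁(¼,¼;1;x)² = ₃F₂(½,½,½;1,1;x), as
representations at every real algebraic x₀ ∈ (0,1): r = [(0,1)², Π_{i=0,1}
xᵢ^(−3/4)(1−xᵢ)^(−1/4)(1−x₀xᵢ)^(−1/4)] (value 2π²·₂F₁², the PRODUCT presentation) and r′ = [(0,1)²,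
2(x₀… )]: 2·(ts(1−t)(1−s)(1−x₀ts))^(−1/2) (value 2π²·₃F₂, the canonical Katz presentation
ad∘mc_½∘ad∘mc_½ of h = (w(1−w))^(−1/2)); checked here: both 21.348833791… at x₀ = ½, identity to
2e−16 at x₀ = 0.1…0.9. Claim: [π]·([π]·([r] − [r′])) ∈ KZ.relations, written in the P-form (∀ pinned
P, lift P (lift P ([r] − [r′])) ∈ relations) — exactly what the two-step tower delivers (each
inverse Euler step at λ = ½ multiplies by [B(½,½)] ~ [π], support BetaHalfPi); the absolute
equivalence is support ClausenQuarter (= this + PiCancellation twice). [difficulty: XL] (why it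
might fail: The product side is no Euler presentation on ONE rigid family: its descent
∭2f·∂ₛf·(x−s)^(−1/2) must be uniformly rank-1-transportable with a semialgebraic certificate on a
4-box to a non-resonant anchor; if Clausen compiles only via Shioda–Inose (card ramanujan-pi-series)
no certificate exists.) [Clausen1828, AndrewsAskeyRoy1999, Haraoka2020, BeukersHeckman1989,
KontsevichZagier2001]
#3 BetaWall (crux) — Conjecture 1 on the Beta-monomial sector (the Γ-wall the tower isolates; card
K4 GammaRatioWall): two Beta boxes β (dimension k) and β′ (dimension l) — domain (0,1)^k, integrand
C·Πᵢ xᵢ^pᵢ(1−xᵢ)^qᵢ with p, q rational and C real algebraic — with equal values are KZ-equivalent.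
Translation and reflection instances are Dirichlet chaining / Baker-stratum moves (provable);
Gauss-multiplication instances are route Neg's bet (first instance = support TriplicationAccessible
= Neg 0312); by Rohrlich–Lang nothing else is expected, but the statement quantifies over all true
identities. [difficulty: open-problem] (why it might fail: Neg's rank-2 bet (stmt-0311):
B(1/9,4/9)B(5/9,7/9) = 2·3^(7/6)π may be inaccessible — multiplication-type Γ-identities are proved
only through Γ or Fermat Hodge classes (Deligne1982HodgeCycles §7), never yet by real algebraic
changes of variables; one inaccessible pair refutes it and the summit.) [Deligne1982HodgeCycles,
KoblitzRohrlich1978, Waldschmidt2006, KontsevichZagier2001]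
#4 PiCancellation (crux) — [π] is a non-zero-divisor modulo the moves: [π]·c ∈ KZ.relations → c ∈
KZ.relations, stated VERBATIM as AyoubSpecialisation's item 0540 (P-form: ∀ pinned padding operators
P, lift P c ∈ relations → c ∈ relations), i.e. the same ledger item, equivalent to the tree's open
Prop KZ.PiCancellation (which this file deliberately does not import) and to SpectatorSlicing's
CarrierRigidity programme. Load-bearing here because every inverse Euler step of the tower
multiplies by a Beta spectator ~ algebraic·[π]. [difficulty: open-problem] (why it might fail: A
certificate for [π]·c may mix the two disc coordinates with c's (carrier migration), leaving no
shadow certificate for c; the motivic shadow (P̃^eff → P̃ injective) is printed as OPEN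
(HuberWustholz2022 App. A.4); one witness refutes the summit.) [HuberWustholz2022,
AyoubRelKZRevisited, Ayoub2014, KontsevichZagier2001]
#9 TowerStep (support) — The inverse Euler-transform step as a relation (card K1, corrected: a
general fractional-calculus identity, no rigidity needed): for a pencil with integrand g(t,s) on D ×
[a,x₀] (a < x₀ real algebraic, g ℚ-semialgebraic, s ↦ g(t,s) continuous on [a,x₀] and differentiable
inside with derivative g′) and 0 < λ < 1 rational, [D × {a<s<u<x₀}, g′(t,s)(u−s)^(−λ)(x₀−u)^(λ−1)] −
([D × (0,1), g(t,x₀)·v^(−λ)(1−v)^(λ−1)] − [D × (0,1), g(t,a)·v^(−λ)(1−v)^(λ−1)]) ∈ KZ.relations (rev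
1: the Beta factor is the LAST COORDINATE v of the two explicit representations ρ₁, ρ₀ — exactly
what the chain outputs — instead of a FormalRep product). Chain: change of variables v =
(u−s)/(x₀−s) (Haraoka2020 proof of Thm 7.4 (ii); the (x₀−s)-powers cancel), coordinate swap, ONE
Newton–Leibniz move along s with primitive g·v^(−λ)(1−v)^(λ−1), integrand additivity, null boundary
pieces (no product import needed). [difficulty: L] [Haraoka2020, Oshima2012, KontsevichZagier2001]
#9 KZStokesBox (support) — Stokes on an open box with a primitive vanishing on the two faces of the
last coordinate gives [r] ∈ KZ.relations (verbatim the support item 3015 of route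
GaussManinCertificates; used for the rank-one transport certificates ∂_w(ρ/h) = Σ ∂_tᵢ Gᵢ at the
bottom of the tower). [difficulty: provable-now] [KontsevichZagier2001, AyoubRelKZRevisited]
#9 BetaHalfPi (support) — B(½,½) = π inside the rules: [(0,1), (v(1−v))^(−1/2)] ~ [unit disc, 1]
(any representation δ with domain {x 0² + x 1² ≤ 1} and integrand 1 there; v = (1+w)/2, then KZ's
own step ∫(1−w²)^(−1/2) = 2∫√(1−w²) by one Newton–Leibniz move, then the band |y| ≤ √(1−w²) = unit
disc). Converts the tower's Beta spectators at λ = ½ into [π] (relations is a two-sided ideal: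
KZ.mul_mem_relations_left/right_holds, KZProductIdeal — importable in Theorems files). [difficulty:
provable-now] [KontsevichZagier2001, AndrewsAskeyRoy1999]
#9 DiscPadding (support) — The construction statement of the P-form: there is P with (P n r).domain
= {z : Fin (n+2) → ℝ | z 0² + z 1² ≤ 1 ∧ (i ↦ z i.succ.succ) ∈ r.domain} and (P n r).integrand =
r.integrand ∘ (i ↦ z i.succ.succ) for all n, r (semialgebraic cylinder, composition with a
projection, Fubini integrability on disc × domain; adapt KZProduct's piRep.prod with the disc in the
two LEADING coordinates of Fin (n+2)). Needed by `closes` to instantiate the ∀P-forms; also turns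
AyoubSpecialisation's 0540 ∧ 0541 into its thesis 0538. [difficulty: provable-now, M]
[KontsevichZagier2001, Ayoub2014]
#9 TriplicationAccessible (support) — First Gauss-multiplication instance of BetaWall, verbatim
route Neg's 0312 (shared): the box rep of B(1/9,4/9)·B(5/9,7/9) is KZ-equivalent to the disc of
radius 2 with constant 3^(7/6)/2 (value 2π·3^(7/6) = 22.6371282948…). Listed so that this route is
attached to the wall item it isolates; not attacked by the tower. [difficulty: open-problem]
[Deligne1982HodgeCycles, Waldschmidt2006, KontsevichZagier2001]
#9 ClausenQuarter (support) — The absolute form of ClausenQuarterModPi: r ~ r′ for every real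
algebraic x₀ ∈ (0,1) (two lines from ClausenQuarterModPi and PiCancellation, Sketch.lean; also an
instance of the summit, so a refutation refutes Conjecture 1 and decides card ramanujan-pi-series'
claim that Clausen compiles only through Shioda–Inose). [difficulty: XL] [Clausen1828,
AndrewsAskeyRoy1999, KontsevichZagier2001]

TWO-LAYER PLAN. Foreseen glued splits (k ≤ 3, depth 1), filed only when a crux closes or a seat
asks: ClausenQuarterModPi ⇐ ClausenDescent (TowerStep twice on
both presentations, the inner step through FibrewiseIntegration; anchors 𝓔₁(0) = B(¼,¾)², 2𝓔_can(0)
= 2B(½,½)² are reflection-type Beta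
identities) → ClausenBottomTransport (uniform rank-one transport of the two 4-dimensional bottom
pencils, value c·(h(w) − w^(−1/2)), to a
non-resonant anchor with KZStokesBox certificates + AnchorSpecialisation) → ClausenQuarterModPi.
BetaWall ⇐ BetaTranslationReflection
(provable) → BetaMultiplication (Neg 0312-type family) → BetaWall (Rohrlich–Lang shape; the glue is
conditional on no exotic Γ-relations and
would be filed as such). Informal cruxes filed right after open (signatures later): 5
FibrewiseIntegration (uniform semialgebraic templates of
moves over the algebraic points of an interval integrate to an equivalence of the total
representations — over KZMoveFamily's
UniformlyEquivalentOn, whose olean the farm could not serve today), 6 AnchorSpecialisation (Oshima's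
connection coefficients inside the rules:
the regularised special fibre of a rank-one Euler-type pencil at a non-resonant singular point is a
Beta box, reached by transport + dominated
specialisation), 7 RigidSectorModBeta (the sector theorem: the rigid sector of BetaLocalKernel).

KILL CRITERIA. Refutation of ClausenQuarterModPi (an additive invariant killing the four move sets
and [π]²·([r] − [r′])) closes the route `refuted:ClausenQuarterModPi`
AND refutes the summit (values are equal) — hand the invariant to Neg (NegObstructionShape 0313).
Refutation of BetaWall (= Neg's 0311 proved)
or of PiCancellation refutes the summit outright; this route then closes with every positive route.
Refutation of TowerStep as typed (side
conditions) forces a restatement, not a pivot. If RigidSectorModBeta dies at FibrewiseIntegration (a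
fibrewise-uniform template that does not
integrate), pivot to canonical presentations only (Katz representations of one family: the route
degenerates to CubicTransport-type transport
and should be closed `superseded`). KZKernelConjecture or PiLocalKernel proved elsewhere moots
BetaLocalKernel (both imply it, Sketch.lean).

NOT DECOMPOSED YET. The uniform rank-one transport lemma with explicit certificate hypotheses (a
composite of a Newton–Leibniz family in the parameter and
KZStokesBox families; filed as a child of ClausenQuarterModPi when a prover asks); existence of
certificates for tower bottoms (relative
twisted de Rham, Aomoto–Kita) — instance by instance; the anchor-defect bookkeeping (naive versus
middle convolution: S G = x^(−1/2)(K̃(x) − 1)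
in the ₃F₂(½,½,½;1,1) example, checked by series algebra n·gₙ·B(n,½) = kₙ); resonant anchors; the
Rohrlich–Lang shape of BetaWall; any
second typed instance (Thomae/Dixon/Watson ₃F₂ presentations, Beukers–Heckman algebraic ₙFₙ₋₁) until
ClausenQuarterModPi moves.

CHEAPEST FALSIFIER. Numerics first (done): the two Clausen representations agree (21.348833791… at
x₀ = ½; series identity to 2e−16 on (0,1)). Next cheapest, for a
refuter with kit: compute the one-step descent of the PRODUCT presentation, S(F²)(x) = ∫₀ˣ
∂ₛ(F(s)²)(x−s)^(−1/2) ds, numerically at three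
algebraic x and test that it equals x^(−1/2)·2π²(K̃(x) − 1)·(normalisation) — the rank-2 pencil
predicted by the spectral type ((21),(111),(111)
→ Gauss); by linearity it must (F² = G as functions), so a FAILURE would expose a
convergence/regularisation error in TowerStep's hypotheses
rather than kill the identity. The decisive cheap test of the MECHANISM is symbolic: does creative
telescoping (HolonomicFunctions/Koutschan)
find a certificate ∂_w(ρ₁/g) = Σ∂_tᵢGᵢ for the 4-dimensional Clausen bottom pencil with Gᵢ vanishing
on the box faces? No certificate ⇒
ClausenBottomTransport is not a uniform chain and the card's rank-descent claim fails for product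
presentations.

NUMBERS. Clausen a = b = ¼: r.value(x₀) = 2π²·₂F₁(¼,¼;1;x₀)² = 19.9970, 20.5936, 21.3488, 22.3927,
24.1995 at x₀ = 0.1, 0.3, 0.5, 0.7, 0.9 (series, 4000
terms; quadrature cross-check 21.34883 at ½). Tower data: ₃F₂(½,½,½;1,1) = ad∘mc_½∘ad∘mc_½ of h =
(w(1−w))^(−1/2) (Haraoka2020 Ex. 6.1 shape;
λ = b₂ − a₃ = ½ twice), so N = 2 in ClausenQuarterModPi; B(½,½) = π, B(¼,¾) = π√2. Triplication wall
value 3Γ(1/9)Γ(4/9)Γ(7/9)/Γ(1/3) =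
2π·3^(7/6) = 22.6371282948… (Neg 0311/0312). Items at open: 11 (1 target, 3 typed cruxes, 1
assembly, 6 support); 3 informal cruxes follow. Rev 1 (cone repair 2026-08-15): 5 items restated
import-free (BetaLocalKernel, ClausenQuarterModPi, PiCancellation = 0540, TowerStep, BetaHalfPi),
Assembly and `closes` gain DiscPadding, imports KZProduct → KZMoveFamily; 14 items.

DEFINITION REQUESTS. None blocking. FibrewiseIntegration (9891) is stated over
`Literature.NumberTheory.Transcendental.KZ.UniformlyEquivalentOn`
(KZMoveFamily.lean, imported by the route file since rev 1; signature set by grounder g15-8). An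
optional bookkeeping structure `EulerTypePencil` (exponent matrix, real algebraic
points, box cycle) would shorten RigidSectorModBeta; not requested until ClausenQuarterModPi moves.
Bib keys Haraoka2020 and Oshima2012 added
this session (commit c6064343a30a).

Novelty: Searches (2026-08-15): `lit search --hybrid "middle convolution Riemann-Liouville Euler transform
rigid local system period conjecture"` (12
docs; only relevant hit book:haraoka2020, PDF pp. 131–132 (Thm 7.4–7.5), 115–116 (Thm 6.2, Oshima
Lemma 12.2), 159–161 (Thm 7.22–7.23) read);
`lit galaxy search "middle convolution" --star all` (25 rows: Haraoka LNM 2271 (panama), Geißler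
2017 thesis "Enhanced middle convolution",
Filipuk on Heun/Painlevé — none relating middle convolution to periods or to a calculus of moves);
zbMATH "middle convolution hypergeometric"
(12: Haraoka 2012/2020/2023, Oshima 2017 ×2, Arai–Takemura q-mc 2023/2026, Katz1996, Filipuk 2009,
da Silva–Kerr–Pearlstein 2016 — values
and monodromy level only); zbMATH "period conjecture Kontsevich Zagier" ≥ 2015 (6: Ayoub2015,
HuberWustholz2022, CressonViusos2022, Viu-Sos
2021, arXiv:2507.15020, Moerman 2022); zbMATH/arXiv "middle convolution period(s) Kontsevich Zagier"
(0/0); `lit frontier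
KontsevichZagierPeriods --since 2021` (30 rows, none on Katz–Oshima theory); `lit bridges --cross
any` (30, none); hub: grep of all 70 route
files for middle convolution / Katz / Oshima / Riemann–Liouville / rank descent (1 bibliographic
mention, RamanujanComposites).
Nearest prior art found: Haraoka2020 / Oshima2012 (doi:10.2969/msjmemoirs/028010000) / Katz1996 —
rank descent and Γ-ratio connection
coefficients at the level of functions and monodromy, no statement about period identities or moves;
on the hub, route RamanujanComp  [refs: 10.2969/msjmemoirs/028010000, 2507.15020, book:haraoka2020, doi:10.2969/msjmemoirs/028010000, Katz1996, Ayoub2015, HuberWustholz2022, CressonViusos2022, Haraoka2020, Oshima2012]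

Barriers (technique_class: integral-transform-moves rank-descent pi-localisation): - technique_class: integral-transform-moves rank-descent pi-localisation
- Literature.Barriers.KontsevichZagierPeriods.noSemialgebraicPrimitive_inv_sub_two: evaded
structurally — the only primitives are the pencil's own integrand (parameter-direction
Newton–Leibniz in TowerStep) and polynomial/Beta ones (BetaHalfPi, KZStokesBox certificates); every
Euler integral is an extra VARIABLE, never a closed-form primitive (Ayoub's "more variables" is
embraced: tower height = rank − 1).
- Literature.Barriers.KontsevichZagierPeriods.kzConjecture_implies_oddZetaAlgIndep: strength barrier
— carried by BetaLocalKernel alone (openly GPC-strength, like every target on this summit); the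
sector statements (ClausenQuarterModPi, TowerStep, RigidSectorModBeta) assert no transcendence: they
are implied by the summit and speak only about the calculus; BetaWall and PiCancellation are the two
named walls, isolated not evaded.
- Literature.Barriers.KontsevichZagierPeriods.kzConjecture_implies_twoPiI_log_algIndep: same — only
BetaLocalKernel carries it; the route's own contribution is [π]-LOCALISED by design, so 2πi-torsion
is quotiented out exactly where Ayoub's relative theorem says it must be.
- Literature.Barriers.KontsevichZagierPeriods.kzConjecture_implies_ellipticPeriods_algIndep: not
engaged by the sector items (rigid hypergeometric pencils at algebraic arguments include CM elliptic
periods only through Clausen/Legendre-type identities, which the route derives functionally, never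
by evaluating

History (route lifecycle, newest last):
- 2026-08-15T16:38:12Z · rev 1: restated BetaLocalKernel (stmt-KontsevichZagierPeriods-9883), ClausenQuarterModPi (stmt-KontsevichZagierPeriods-9884), PiCancellation (stmt-KontsevichZagierPeriods-9886), TowerStep (stmt-KontsevichZagierPeriods-9887), BetaHalfPi (stmt-KontsevichZagierPeriods-9888), Assembly (stmt-KontsevichZagierPeriods-9890) —  (planner-rrepair-KontsevichZagierPeriods-KatzTo-2321a8aa-g2-0)
- 2026-08-16T02:18:49Z · AUTO-CRUX: 1 conjecture-grade item(s) promoted to crux (BetaLocalKernel) — refuter vetting / tiering apply (operator:999:1362873)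
- 2026-08-16T04:08:45Z · AUTO-CRUX (backfill): BetaLocalKernel — hypotheses of the deciding theorem that nothing in the route derives are cruxes (operator:999:1085951)
- 2026-08-23T21:55:36Z · DORMANT — reconciler: no traction for 6.3 d (last activity item-evidence-added at 2026-08-17T14:41:05Z); parked, not closed — `ledger route dormant route-KontsevichZagier (operator:999:855452)
- 2026-08-30T03:38:37Z · REACTIVATED — reconciler: reactivated — activity statement-attached at 2026-08-30T02:51:58Z after parking at 2026-08-23T21:55:36Z (operator:999:4078272)
- 2026-09-04T21:46:34Z · DORMANT — reconciler: no traction for 5 d (last activity item-evidence-added at 2026-08-30T20:47:30Z); parked, not closed — `ledger route dormant route-KontsevichZagierPe (operator:999:4174424)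

sub-problem: KontsevichZagierPeriods · status: dormant · opened planner-plancard-KontsevichZagierPeriods-Kont-dc72cea3-0 2026-08-15T14:43:41Z · rev 1 · ledger route-KontsevichZagierPeriods-KatzTower
GENERATED by the gate from the ledger (D-0016/17). Provers cite these decls: `theorem foo : Summit.KontsevichZagierPeriods.KontsevichZagierPeriods.Theses.KatzTower.<Decl> := …` in Summits/KontsevichZagierPeriods/KontsevichZagierPeriods/Theorems/<Name>.lean.
-/

namespace Summit.KontsevichZagierPeriods.KontsevichZagierPeriods.Theses.KatzTower

open scoped BigOperators Topology Manifold Classical MeasureTheory ProbabilityTheory Matrix InnerProductSpace ComplexConjugate ContinuousMap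
open Filter Set Function TopologicalSpace MeasureTheory

attribute [summit_statement] _root_.KontsevichZagierPeriods

open Literature Periods

-- earlier BetaLocalKernel (stmt-KontsevichZagierPeriods-9883, replaced 2026-08-15T16:38:12Z -> stmt-KontsevichZagierPeriods-11050): retired by None — ∀ c : Literature.NumberTheory.Transcendental.KZ.FormalRep, Literature.NumberTheory.Transcendental.KZ.eval c = 0 → ∃ N : ℕ, (fun x => Literature.NumberTheory.Transcendental.KZ.of Literature.NumberTheory.Transcendental.KZ.piRep * x)^[N] c ∈ Literature.Nu
/-- item stmt-KontsevichZagierPeriods-11050 · aside (kind.auto-crux: conjecture-grade) · rank 0 · open · by planner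
why it might fail: It is Conjecture 1 up to π-torsion and Γ-values (GPC strength): false iff some vanishing combination is missed by moves + Beta identities even after ×[π]^N — Neg's pressure points (a) regularised MZV relations and (c) transcendental primitives are untouched by the tower.
sources: KontsevichZagier2001, HuberMullerStach2017, Ayoub2014, Haraoka2020, Oshima2012
[target] Conjecture 1 localised at [π] and modulo Beta-monomial identities, in the import-free
P-FORM of AyoubSpecialisation 0541 (rev 1, cone repair): for every padding operator P pinned by (P n
r).domain = {z : Fin (n+2) → ℝ | z 0² + z 1² ≤ 1 ∧ (i ↦ z i.succ.succ) ∈ r.domain} and (P n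
r).integrand = r.integrand ∘ (i ↦ z i.succ.succ) (so [P r] = [π]·[r]; P is unique once it exists,
existence = support DiscPadding), and every formal combination c with KZ.eval c = 0, there is N with
(lift P)^[N] c ∈ KZ.relations ⊔ closure{[β] − [β′] : β, β′ Beta boxes (domain (0,1)^k, integrand
C·Πᵢ xᵢ^pᵢ(1−xᵢ)^qᵢ, p, q ∈ ℚ, C real algebraic) with β.value = β′.value}. Literally 0541's
statement with the Beta closure joined, hence implied by PiLocalKernel (0541) and by
KZKernelConjecture; the rigid sector of it is what the tower proves (informal crux
RigidSectorModBeta 9894). -/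
@[route_item "route-KontsevichZagierPeriods-KatzTower"]
def BetaLocalKernel : Prop :=
  ∀ (P : ∀ n : ℕ, Literature.NumberTheory.Transcendental.KZ.IntegralRep n → Literature.NumberTheory.Transcendental.KZ.IntegralRep (n + 2)), (∀ (n : ℕ) (r : Literature.NumberTheory.Transcendental.KZ.IntegralRep n), (P n r).domain = {z : Fin (n + 2) → ℝ | z 0 ^ 2 + z 1 ^ 2 ≤ 1 ∧ (fun i : Fin n => z i.succ.succ) ∈ r.domain} ∧ (P n r).integrand = fun z => r.integrand (fun i : Fin n => z i.succ.succ)) → ∀ c : Literature.NumberTheory.Transcendental.KZ.FormalRep, Literature.NumberTheory.Transcendental.KZ.eval c = 0 → ∃ N : ℕ, (⇑(FreeAbelianGroup.lift (fun s : (Σ n, Literature.NumberTheory.Transcendental.KZ.IntegralRep n) => Literature.NumberTheory.Transcendental.KZ.of (P s.1 s.2))))^[N] c ∈ Literature.NumberTheory.Transcendental.KZ.relations ⊔ AddSubgroup.closure {d : Literature.NumberTheory.Transcendental.KZ.FormalRep | ∃ (k l : ℕ) (β : Literature.NumberTheory.Transcendental.KZ.IntegralRep k) (β' : Literature.NumberTheory.Transcendental.KZ.IntegralRep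 l) (C C' : ℝ) (p q : Fin k → ℚ) (p' q' : Fin l → ℚ), IsAlgebraic ℚ C ∧ IsAlgebraic ℚ C' ∧ β.domain = {x | ∀ i, x i ∈ Set.Ioo (0:ℝ) 1} ∧ Set.EqOn β.integrand (fun x => C * ∏ i, (x i) ^ ((p i : ℝ)) * (1 - x i) ^ ((q i : ℝ))) β.domain ∧ β'.domain = {x | ∀ i, x i ∈ Set.Ioo (0:ℝ) 1} ∧ Set.EqOn β'.integrand (fun x => C' * ∏ i, (x i) ^ ((p' i : ℝ)) * (1 - x i) ^ ((q' i : ℝ))) β'.domain ∧ β.value = β'.value ∧ d = Literature.NumberTheory.Transcendental.KZ.of β - Literature.NumberTheory.Transcendental.KZ.of β'}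

-- earlier ClausenQuarterModPi (stmt-KontsevichZagierPeriods-9884, replaced 2026-08-15T16:38:12Z -> stmt-KontsevichZagierPeriods-11051): retired by None — ∀ x₀ : ℝ, IsAlgebraic ℚ x₀ → 0 < x₀ → x₀ < 1 → ∀ (r r' : Literature.NumberTheory.Transcendental.KZ.IntegralRep 2), r.domain = {x | ∀ i, x i ∈ Set.Ioo (0:ℝ) 1} → Set.EqOn r.integrand (fun x => ((x 0) ^ (-(3:ℝ)/4) * (1 - x 0) ^ (-(1:ℝ)/4) * (1 - x₀ *
/-- item stmt-KontsevichZagierPeriods-11051 · aside · rank 2 · open · by planner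
why it might fail: The product side is no Euler presentation on ONE rigid family: its descent ∭2f·∂ₛf·(x−s)^(−1/2) must be uniformly rank-1-transportable with a semialgebraic certificate on a 4-box to a non-resonant anchor; if Clausen compiles only via Shioda–Inose (card ramanujan-pi-series) no certificate exists.
sources: Clausen1828, AndrewsAskeyRoy1999, Haraoka2020, BeukersHeckman1989, KontsevichZagier2001
[crux] Clausen 1828 at a = b = 1/4, ₂F₁(¼,¼;1;x)² = ₃F₂(½,½,½;1,1;x), as representations at every
real algebraic x₀ ∈ (0,1): r = [(0,1)², Π_{i=0,1} xᵢ^(−3/4)(1−xᵢ)^(−1/4)(1−x₀xᵢ)^(−1/4)] (value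
2π²·₂F₁², the PRODUCT presentation) and r′ = [(0,1)², 2·(ts(1−t)(1−s)(1−x₀ts))^(−1/2)] (value
2π²·₃F₂, the canonical Katz presentation ad∘mc_½∘ad∘mc_½ of h = (w(1−w))^(−1/2)); both 21.348833791…
at x₀ = ½ (refuter evidence clausen_numerics.md on the rev-0 item 9884), identity to 2e−16 at x₀ =
0.1…0.9. Claim: [π]·([π]·([r] − [r′])) ∈ KZ.relations, written since rev 1 in the import-free P-form
(∀ pinned padding operators P: lift P (lift P ([r] − [r′])) ∈ relations; P exists by support
DiscPadding) — exactly what the two-step tower delivers (each inverse Euler step at λ = ½ multiplies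
by [B(½,½)] ~ [π], supports TowerStep + BetaHalfPi); the absolute equivalence is support
ClausenQuarter (= this + PiCancellation twice). [difficulty: XL] -/
@[route_item "route-KontsevichZagierPeriods-KatzTower"]
def ClausenQuarterModPi : Prop :=
  ∀ (P : ∀ n : ℕ, Literature.NumberTheory.Transcendental.KZ.IntegralRep n → Literature.NumberTheory.Transcendental.KZ.IntegralRep (n + 2)), (∀ (n : ℕ) (r : Literature.NumberTheory.Transcendental.KZ.IntegralRep n), (P n r).domain = {z : Fin (n + 2) → ℝ | z 0 ^ 2 + z 1 ^ 2 ≤ 1 ∧ (fun i : Fin n => z i.succ.succ) ∈ r.domain} ∧ (P n r).integrand = fun z => r.integrand (fun i : Fin n => z i.succ.succ)) → ∀ x₀ : ℝ, IsAlgebraic ℚ x₀ → 0 < x₀ → x₀ < 1 → ∀ (r r' : Literature.NumberTheory.Transcendental.KZ.IntegralRep 2), r.domain = {x | ∀ i, x i ∈ Set.Ioo (0:ℝ) 1} → Set.EqOn r.integrand (fun x => ((x 0) ^ (-(3:ℝ)/4) * (1 - x 0) ^ (-(1:ℝ)/4) * (1 - x₀ * x 0) ^ (-(1:ℝ)/4))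 * ((x 1) ^ (-(3:ℝ)/4) * (1 - x 1) ^ (-(1:ℝ)/4) * (1 - x₀ * x 1) ^ (-(1:ℝ)/4))) r.domain → r'.domain = {x | ∀ i, x i ∈ Set.Ioo (0:ℝ) 1} → Set.EqOn r'.integrand (fun x => 2 * (x 0 * x 1 * (1 - x 0) * (1 - x 1) * (1 - x₀ * x 0 * x 1)) ^ (-(1:ℝ)/2)) r'.domain → FreeAbelianGroup.lift (fun s : (Σ n, Literature.NumberTheory.Transcendental.KZ.IntegralRep n) => Literature.NumberTheory.Transcendental.KZ.of (P s.1 s.2)) (FreeAbelianGroup.lift (fun s : (Σ n, Literature.NumberTheory.Transcendental.KZ.IntegralRep n) => Literature.NumberTheory.Transcendental.KZ.of (P s.1 s.2)) (Literature.NumberTheory.Transcendental.KZ.of r - Literature.NumberTheory.Transcendental.KZ.of r')) ∈ Literature.NumberTheory.Transcendental.KZ.relations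

/-- item stmt-KontsevichZagierPeriods-9885 · aside · rank 3 · open · by planner
why it might fail: Neg's rank-2 bet (stmt-0311): B(1/9,4/9)B(5/9,7/9) = 2·3^(7/6)π may be inaccessible — multiplication-type Γ-identities are proved only through Γ or Fermat Hodge classes (Deligne1982HodgeCycles §7), never yet by real algebraic changes of variables; one inaccessible pair refutes it and the summit.
sources: Deligne1982HodgeCycles, KoblitzRohrlich1978, Waldschmidt2006, KontsevichZagier2001
[crux] Conjecture 1 on the Beta-monomial sector (the Γ-wall the tower isolates; card K4
GammaRatioWall): two Beta boxes β (dimension k) and β′ (dimension l) — domain (0,1)^k, integrand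
C·Πᵢ xᵢ^pᵢ(1−xᵢ)^qᵢ with p, q rational and C real algebraic — with equal values are KZ-equivalent.
Translation and reflection instances are Dirichlet chaining / Baker-stratum moves (provable);
Gauss-multiplication instances are route Neg's bet (first instance = support TriplicationAccessible
= Neg 0312); by Rohrlich–Lang nothing else is expected, but the statement quantifies over all true
identities. [difficulty: open-problem] -/
@[route_item "route-KontsevichZagierPeriods-KatzTower"]
def BetaWall : Prop :=
  ∀ (k l : ℕ) (β : Literature.NumberTheory.Transcendental.KZ.IntegralRep k) (β' : Literature.NumberTheory.Transcendental.KZ.IntegralRep l) (C C' : ℝ) (p q : Fin k → ℚ) (p' q' : Fin l → ℚ), IsAlgebraic ℚ C → IsAlgebraic ℚ C' → β.domain = {x | ∀ i, x i ∈ Set.Ioo (0:ℝ) 1} → Set.EqOn β.integrand (fun x => C * ∏ i, (x i) ^ ((p i : ℝ)) * (1 - x i) ^ ((q i : ℝ))) β.domain → β'.domain = {x | ∀ i, x i ∈ Set.Ioo (0:ℝ) 1} → Set.EqOn β'.integrand (fun x => C' * ∏ i, (x i) ^ ((p' i : ℝ)) * (1 - x i) ^ ((q' i : ℝ))) β'.domain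 → β.value = β'.value → Literature.NumberTheory.Transcendental.KZ.Equivalent β β'

-- earlier PiCancellation (stmt-KontsevichZagierPeriods-9886, replaced 2026-08-15T16:38:12Z -> stmt-KontsevichZagierPeriods-0540): retired by None — ∀ c : Literature.NumberTheory.Transcendental.KZ.FormalRep, Literature.NumberTheory.Transcendental.KZ.of Literature.NumberTheory.Transcendental.KZ.piRep * c ∈ Literature.NumberTheory.Transcendental.KZ.relations → c ∈ Literature.NumberTheory.Transcendental
/-- item stmt-KontsevichZagierPeriods-0540 · aside · rank 4 · open · by planner
why it might fail: A certificate for [π]·c may mix the two disc coordinates with c's (carrier migration), leaving no shadow certificate for c; the motivic shadow (P̃^eff → P̃ injective) is printed as OPEN (HuberWustholz2022 App. A.4); one witness refutes the summit.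
sources: HuberWustholz2022, AyoubRelKZRevisited, Ayoub2014, KontsevichZagier2001
PiCancellation := ∀ c : Literature.NumberTheory.Transcendental.KZ.FormalRep, (of piRep) ⋆ c ∈
Literature.NumberTheory.Transcendental.KZ.relations → c ∈
Literature.NumberTheory.Transcendental.KZ.relations, piRep = closed unit disc with integrand 1 (d =
2). A consequence of S (eval (piRep ⋆ c) = π · eval c by Fubini, π ≠ 0), but transcendence-free: it
is a regular-element property of the presented abelian group FormalRep/relations under the product,
and the exact point where Ayoub's relative theorem fails to be effective (AyoubRelKZRevisited Rem
1.3: the torsor exists only over D((2πi)⁻¹)) and where HuberMullerStach2017 §13 passes from P^eff to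
P = P^eff[(2πi)⁻¹]. Independent of the chosen π-representation once `relations` is an ideal under ⋆
(part of the def request). Attack suggestions: (i) normal forms for ⋆-multiples of disc reps (the
disc factor occupies two leading coordinates untouched by NL along the last coordinate; CoV may mix
them — the crux is whether a relation certificate for piRep ⋆ c can be 'projected' to one for c,
e.g. by restricting/fibrewise-specialising the disc coordinates at a rational point and using domain
additivity); (ii) small cases: c supported in dimensi -/
@[route_item "route-KontsevichZagierPeriods-KatzTower"]
def PiCancellation : Prop :=
  ∀ (P : ∀ n : ℕ, Literature.NumberTheory.Transcendental.KZ.IntegralRep n → Literature.NumberTheory.Transcendental.KZ.IntegralRep (n + 2)), (∀ (n : ℕ) (r : Literature.NumberTheory.Transcendental.KZ.IntegralRep n), (P n r).domain = {z : Fin (n + 2) → ℝ | z 0 ^ 2 + z 1 ^ 2 ≤ 1 ∧ (fun i : Fin n => z i.succ.succ) ∈ r.domain} ∧ (P n r).integrand = fun z => r.integrand (fun i : Fin n => z i.succ.succ)) → ∀ c : Literature.NumberTheory.Transcendental.KZ.FormalRep, FreeAbelianGroup.lift (fun s : (Σ n, Literature.NumberTheory.Transcendental.KZ.IntegralRep n)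 => Literature.NumberTheory.Transcendental.KZ.of (P s.1 s.2)) c ∈ Literature.NumberTheory.Transcendental.KZ.relations → c ∈ Literature.NumberTheory.Transcendental.KZ.relations

/-- item stmt-KontsevichZagierPeriods-9891 · support · rank 5 · open · by planner
[crux] FIBREWISE INTEGRATION (the engine that lets a chain run INSIDE an outer Euler integral;
needed from the second level of the tower on). Let I ⊆ ℝ be an interval with real algebraic ends and
T = {t ∈ I | IsAlgebraic ℚ t}. Let R : ℝ → KZ.IntegralRep n, R' : ℝ → KZ.IntegralRep m be families
with Literature.NumberTheory.Transcendental.KZ.UniformlyEquivalentOn T R R' (KZMoveFamily.lean: ONE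
template of k move instances whose data vary ℚ-semialgebraically with t), and let ρ : IntegralRep
(n+1), ρ' : IntegralRep (m+1) be TOTAL representations over I: ρ.domain ⊆ {z | z (Fin.last n) ∈ I}
and for every t ∈ T the slice {x | Fin.snoc x t ∈ ρ.domain} = (R t).domain with EqOn (x ↦
ρ.integrand (Fin.snoc x t)) (R t).integrand there (likewise ρ', R'). CLAIM: KZ.Equivalent ρ ρ'.
Intended signature (elaborates locally in shape; NOT filed because the Lean farm served KZMoveFamily
as unbuilt — remote:stale:15 — all session; a grounder/tenure pass should `set-signature` once it
builds): ∀ ⦃n m : ℕ⦄ (I : Set ℝ) (R …) (R' …) (ρ …) (ρ' …), KZ.UniformlyEquivalentOn {t | t ∈ I ∧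
IsAlgebraic ℚ t} R R' → ρ.domain ⊆ {z | z (Fin.last n) ∈ I} → (∀ t ∈ I, IsAlgebraic ℚ t → {x |
(Fin.snoc x t : Fin (n+1) → ℝ) -/
@[route_item "route-KontsevichZagierPeriods-KatzTower"]
def FibrewiseIntegration : Prop :=
  ∀ ⦃n m : ℕ⦄ (I : Set ℝ) (R : ℝ → Literature.NumberTheory.Transcendental.KZ.IntegralRep n) (R' : ℝ → Literature.NumberTheory.Transcendental.KZ.IntegralRep m) (ρ : Literature.NumberTheory.Transcendental.KZ.IntegralRep (n + 1)) (ρ' : Literature.NumberTheory.Transcendental.KZ.IntegralRep (m + 1)), Literature.NumberTheory.Transcendental.KZ.UniformlyEquivalentOn {t | t ∈ I ∧ IsAlgebraic ℚ t} R R' → ρ.domain ⊆ {z | z (Fin.last n) ∈ I} → (∀ t ∈ I, IsAlgebraic ℚ t → {x : Fin n → ℝ | (Fin.snoc x t : Fin (n + 1) → ℝ) ∈ ρ.domain} = (R t).domain ∧ Set.EqOn (fun x => ρ.integrand (Fin.snoc x t)) (R t).integrand (R t).domain) → ρ'.domain ⊆ {z | z (Fin.last m) ∈ I} → (∀ t ∈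 I, IsAlgebraic ℚ t → {x : Fin m → ℝ | (Fin.snoc x t : Fin (m + 1) → ℝ) ∈ ρ'.domain} = (R' t).domain ∧ Set.EqOn (fun x => ρ'.integrand (Fin.snoc x t)) (R' t).integrand (R' t).domain) → Literature.NumberTheory.Transcendental.KZ.Equivalent ρ ρ'

-- item stmt-KontsevichZagierPeriods-9892 · support · rank 6 · open · by planner — informal only, no Lean statement yet:
--   [crux] OSHIMA'S CONNECTION COEFFICIENTS INSIDE THE RULES (anchor evaluation at the bottom of the
--   tower). Setting: a rank-one Euler-type pencil R(w) = [B_q, ρ(·,w)] (B_q the open unit box, ρ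
--   ℚ-semialgebraic in (t,w), rational exponents) produced by the inverse tower S = (gauge ∘ J^{1−λ_i} ∘
--   ∂)_i from an Euler-type presentation of a rigid solution, so that value(R(w)) = c·h(w) on an
--   interval (a_j, b) with h(w) = Π_j |w − a_j|^{α_j} ALGEBRAIC (α_j ∈ ℚ, a_j real algebraic) and c a
--   constant (for the canonical Katz presentation c is Oshima's connection-type Γ-ratio: Haraoka2020 Thm
--   6.2, Oshima2012 L

-- item stmt-KontsevichZagierPeriods-9894 · support · rank 7 · open · by planner — informal only, no Lean statement yet:
--   [crux] THE SECTOR THEOREM OF THE CARD (rigid sector of the target BetaLocalKernel; informal: 'rigid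
--   Fuchsian equation / exponent line / Euler-type presentation' have no Lean vocabulary yet). Let L be
--   an irreducible RIGID Fuchsian equation with real algebraic singular points and RATIONAL local
--   exponents (ₙF_{n−1}, Jordan–Pochhammer, Simpson's families, …). Let E₁, E₂ be Euler-type
--   presentations — absolutely convergent iterated real box integrals of ℚ-semialgebraic integrands
--   algebraic in (t,x) — of solutions of L in a COMMON ONE-DIMENSIONAL local exponent space, on a common
--   real interval J, so

/-- item stmt-KontsevichZagierPeriods-0312 · support · rank 9 · open · by planner
sources: Deligne1982HodgeCycles, Waldschmidt2006, KontsevichZagier2001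
Positive form of #2. A proof must avoid Γ: candidate strategy = realise the degree-9 Fermat-curve
correspondence behind the identity as semialgebraic changes of variables between (blow-ups of)
(0,1)² pieces plus Newton–Leibniz with algebraic primitives (Rohrlich/Deligne distribution relations
are induced by the maps x ↦ x³ on Fermat curves — algebraic, finite ⇒ CoV on injectivity cells). If
found, pressure point (b) of route Neg dies at its first instance. [elaborates: yes:
_survey/SketchB.lean; sources: Deligne1982HodgeCycles, KontsevichZagier2001] -/
@[route_item "route-KontsevichZagierPeriods-KatzTower"]
def TriplicationAccessible : Prop :=
  ∀ (r r' : Literature.NumberTheory.Transcendental.KZ.IntegralRep 2), r.domain = {x | ∀ i, x i ∈ Set.Ioo (0:ℝ) 1} → Set.EqOn r.integrand (fun x => (x 0) ^ (-(8:ℝ)/9) * (1 - x 0) ^ (-(5:ℝ)/9) * (x 1) ^ (-(4:ℝ)/9) * (1 - x 1) ^ (-(2:ℝ)/9)) r.domain → r'.domain = {x | x 0 ^ 2 + x 1 ^ 2 < 4} → Set.EqOn r'.integrand (fun _ => (3:ℝ) ^ ((7:ℝ)/6) / 2) r'.domain → Literature.NumberTheory.Transcendental.KZ.Equivalent r r'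

/-- item stmt-KontsevichZagierPeriods-10941 · support · rank 9 · closed · proved by Summit.KontsevichZagierPeriods.KatzTower.discPadding_proof @ 13bc43be04e8 (prover) · by planner
sources: KontsevichZagier2001, Ayoub2014
[support] the pinned product exists: a family P n r : IntegralRep (n+2) with domain {z | z₀² + z₁² ≤
1 ∧ (z₂,…,z_{n+1}) ∈ r.domain} and integrand z ↦ r.integrand (z₂,…,z_{n+1}) — i.e. [π] ⋆ r;
construction = transport of `Literature.NumberTheory.Transcendental.KZ.piRep.prod r : IntegralRep (2
+ n)` along Fin (2+n) ≃ Fin (n+2) (semialgebraicity of domain/integrand by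
`IsSemialgebraic.preimage_aeval` under the coordinate relabelling, no Tarski–Seidenberg;
integrability by `KZ.IntegralRep.integrableOn_prodFun` and
`MeasureTheory.volume_measurePreserving_piCongrLeft`), or directly by Tonelli. Index bookkeeping
only; it makes the ∀-pinned-P cruxes non-vacuous and is a hypothesis of `closes`. [difficulty:
provable-now]; sources: KontsevichZagier2001 §4.1, BCR1998 Prop. 2.2.6 -/
@[route_item "route-KontsevichZagierPeriods-KatzTower"]
def DiscPadding : Prop :=
  ∃ (P : ∀ n : ℕ, Literature.NumberTheory.Transcendental.KZ.IntegralRep n → Literature.NumberTheory.Transcendental.KZ.IntegralRep (n + 2)), ∀ (n : ℕ) (r : Literature.NumberTheory.Transcendental.KZ.IntegralRep n), (P n r).domain = {z : Fin (n + 2) → ℝ | z 0 ^ 2 + z 1 ^ 2 ≤ 1 ∧ (fun i : Fin n => z i.succ.succ) ∈ r.domain} ∧ (P n r).integrand = fun z => r.integrand (fun i : Fin n => z i.succ.succ)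

-- `DiscPadding` holds: proved by `Summit.KontsevichZagierPeriods.KatzTower.discPadding_proof` @ 13bc43be04e8 (its module imports this route file, so no `_holds` link can be stated here).

-- earlier TowerStep (stmt-KontsevichZagierPeriods-9887, replaced 2026-08-15T16:38:12Z -> stmt-KontsevichZagierPeriods-11052): retired by None — ∀ (q : ℕ) (D : Set (Fin q → ℝ)) (g g' : (Fin (q + 1) → ℝ) → ℝ) (a x₀ : ℝ) (l : ℚ), IsAlgebraic ℚ a → IsAlgebraic ℚ x₀ → a < x₀ → 0 < l → l < 1 → Literature.NumberTheory.Transcendental.IsSemialgebraicFunOn ℚ {w : Fin (q + 1) → ℝ | Fin.init w ∈ D ∧ w (Fin.last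
/-- item stmt-KontsevichZagierPeriods-11052 · support · rank 9 · open · by planner
sources: Haraoka2020, Oshima2012, KontsevichZagier2001
[support] The inverse Euler-transform step as a relation (card K1, corrected: a general
fractional-calculus identity, no rigidity needed): for a pencil with integrand g(t,s) on D × [a,x₀]
(a < x₀ real algebraic, g ℚ-semialgebraic, s ↦ g(t,s) continuous on [a,x₀] and differentiable inside
with derivative g′) and 0 < λ < 1 rational, [D × {a<s<u<x₀}, g′(t,s)(u−s)^(−λ)(x₀−u)^(λ−1)] − ([D ×
(0,1), g(t,x₀)·v^(−λ)(1−v)^(λ−1)] − [D × (0,1), g(t,a)·v^(−λ)(1−v)^(λ−1)]) ∈ KZ.relations — rev 1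
(cone repair): the Beta factor is the LAST COORDINATE v of the explicit representations ρ₁, ρ₀ :
IntegralRep (q+1) (domain {init w ∈ D ∧ w last ∈ (0,1)}), which is literally what the chain outputs,
instead of a FormalRep product. Chain: change of variables v = (u−s)/(x₀−s) (Haraoka2020 proof of
Thm 7.4 (ii); the (x₀−s)-powers cancel), coordinate swap (s last), ONE Newton–Leibniz move along s
with primitive g(t,s)·v^(−λ)(1−v)^(λ−1), integrand additivity, null boundary pieces. [difficulty: L] -/
@[route_item "route-KontsevichZagierPeriods-KatzTower"]
def TowerStep : Prop :=
  ∀ (q : ℕ) (D : Set (Fin q → ℝ)) (g g' : (Fin (q + 1) → ℝ) → ℝ) (a x₀ : ℝ) (l : ℚ), IsAlgebraic ℚ a → IsAlgebraic ℚ x₀ → a < x₀ → 0 < l → l < 1 → Literature.NumberTheory.Transcendental.IsSemialgebraicFunOn ℚ {w : Fin (q + 1) → ℝ | Fin.init w ∈ D ∧ w (Fin.last q) ∈ Set.Icc a x₀} g → (∀ t ∈ D, ContinuousOn (fun s : ℝ => g (Fin.snoc t s)) (Set.Icc a x₀)) → (∀ t ∈ D, ∀ s ∈ Set.Ioo a x₀,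 HasDerivAt (fun σ : ℝ => g (Fin.snoc t σ)) (g' (Fin.snoc t s)) s) → ∀ (ρ : Literature.NumberTheory.Transcendental.KZ.IntegralRep (q + 2)) (ρ₁ ρ₀ : Literature.NumberTheory.Transcendental.KZ.IntegralRep (q + 1)), ρ.domain = {z : Fin (q + 2) → ℝ | Fin.init (Fin.init z) ∈ D ∧ a < Fin.init z (Fin.last q) ∧ Fin.init z (Fin.last q) < z (Fin.last (q + 1)) ∧ z (Fin.last (q + 1)) < x₀} → Set.EqOn ρ.integrand (fun z => g' (Fin.init z) * (z (Fin.last (q + 1)) - Fin.init z (Fin.last q)) ^ (-(l : ℝ)) * (x₀ - z (Fin.last (q + 1))) ^ ((l : ℝ) - 1)) ρ.domain → ρ₁.domain = {w : Fin (q + 1) → ℝ | Fin.init w ∈ D ∧ w (Fin.last q) ∈ Set.Ioo (0:ℝ) 1} → Set.EqOn ρ₁.integrand (fun w => g (Fin.snoc (Fin.init w) x₀) * ((w (Fin.last q)) ^ (-(l : ℝ)) * (1 - w (Fin.last q)) ^ ((l : ℝ) - 1))) ρ₁.domain → ρ₀.domain = {w : Fin (q + 1) → ℝ | Fin.init w ∈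 D ∧ w (Fin.last q) ∈ Set.Ioo (0:ℝ) 1} → Set.EqOn ρ₀.integrand (fun w => g (Fin.snoc (Fin.init w) a) * ((w (Fin.last q)) ^ (-(l : ℝ)) * (1 - w (Fin.last q)) ^ ((l : ℝ) - 1))) ρ₀.domain → Literature.NumberTheory.Transcendental.KZ.of ρ - (Literature.NumberTheory.Transcendental.KZ.of ρ₁ - Literature.NumberTheory.Transcendental.KZ.of ρ₀) ∈ Literature.NumberTheory.Transcendental.KZ.relations

-- earlier BetaHalfPi (stmt-KontsevichZagierPeriods-9888, replaced 2026-08-15T16:38:12Z -> stmt-KontsevichZagierPeriods-11053): retired by None — ∀ (β : Literature.NumberTheory.Transcendental.KZ.IntegralRep 1), β.domain = {v : Fin 1 → ℝ | v 0 ∈ Set.Ioo (0:ℝ) 1} → Set.EqOn β.integrand (fun v => (v 0) ^ (-(1:ℝ)/2) * (1 - v 0) ^ (-(1:ℝ)/2)) β.domain → Literature.NumberTheory.Transcendental.KZ.Equivalent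
/-- item stmt-KontsevichZagierPeriods-11053 · support · rank 9 · closed · proved by Summit.KontsevichZagierPeriods.KatzTower.betaHalfPi_proof @ 055aed9ec054 (prover) · by planner
sources: KontsevichZagier2001, AndrewsAskeyRoy1999
[support] B(½,½) = π inside the rules: [(0,1), (v(1−v))^(−1/2)] ~ [{x 0² + x 1² ≤ 1}, 1] for ANY
representation δ with that domain and integrand 1 on it (rev 1: no KZProduct.piRep import; all such
δ are equivalent by integrand additivity). Chain: v = (1+w)/2, then KZ's own step ∫(1−w²)^(−1/2) =
2∫√(1−w²) by one Newton–Leibniz move, then the band |y| ≤ √(1−w²) = unit disc. Converts the tower's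
Beta spectators at λ = ½ into [π]-paddings (with the ideal property
KZ.mul_mem_relations_left/right_holds of KZProductIdeal, importable in Theorems files). [difficulty:
provable-now] -/
@[route_item "route-KontsevichZagierPeriods-KatzTower"]
def BetaHalfPi : Prop :=
  ∀ (β : Literature.NumberTheory.Transcendental.KZ.IntegralRep 1) (δ : Literature.NumberTheory.Transcendental.KZ.IntegralRep 2), β.domain = {v : Fin 1 → ℝ | v 0 ∈ Set.Ioo (0:ℝ) 1} → Set.EqOn β.integrand (fun v => (v 0) ^ (-(1:ℝ)/2) * (1 - v 0) ^ (-(1:ℝ)/2)) β.domain → δ.domain = {x : Fin 2 → ℝ | x 0 ^ 2 + x 1 ^ 2 ≤ 1} → Set.EqOn δ.integrand (fun _ => (1:ℝ)) δ.domain → Literature.NumberTheory.Transcendental.KZ.Equivalent β δ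

-- `BetaHalfPi` holds: proved by `Summit.KontsevichZagierPeriods.KatzTower.betaHalfPi_proof` @ 055aed9ec054 (its module imports this route file, so no `_holds` link can be stated here).

/-- item stmt-KontsevichZagierPeriods-3015 · support · rank 9 · closed · proved by Summit.KontsevichZagierPeriods.GaussManinCertificates.KZStokesBox_proof @ a749baa749a6 (prover) · by planner
sources: KontsevichZagier2001, AyoubRelKZRevisited
[support] KZStokes on an open box (real corners; ℚ-semialgebraicity is carried by r and by the
hypothesis on H) (one band over the base box: newtonLeibnizRel + two null faces by domain
additivity); unblocks LegendreModulusPropagation without the CAD fact. [difficulty: provable-now] -/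
@[route_item "route-KontsevichZagierPeriods-KatzTower"]
def KZStokesBox : Prop :=
  ∀ (n : ℕ) (a b : Fin (n + 1) → ℝ) (r : Literature.NumberTheory.Transcendental.KZ.IntegralRep (n + 1)) (H : (Fin (n + 1) → ℝ) → ℝ), (∀ i, a i < b i) → r.domain = {z | ∀ i, z i ∈ Set.Ioo (a i) (b i)} → Literature.NumberTheory.Transcendental.IsSemialgebraicFunOn ℚ {z | ∀ i, z i ∈ Set.Icc (a i) (b i)} H → (∀ x : Fin n → ℝ, (∀ i, x i ∈ Set.Ioo (a (Fin.castSucc i)) (b (Fin.castSucc i))) → ContinuousOn (fun s : ℝ => H (Fin.snoc x s)) (Set.Icc (a (Fin.last n)) (b (Fin.last n))) ∧ H (Fin.snoc x (a (Fin.last n))) = 0 ∧ H (Fin.snoc x (b (Fin.last n))) = 0 ∧ ∀ t ∈ Set.Ioo (a (Fin.last n)) (b (Fin.last n)), HasDerivAt (fun s : ℝ => H (Fin.snoc x s)) (r.integrand (Fin.snoc x t)) t) → Literature.NumberTheory.Transcendental.KZ.of r ∈ Literature.NumberTheory.Transcendental.KZ.relations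

/-- `KZStokesBox` holds: proved by `Summit.KontsevichZagierPeriods.GaussManinCertificates.KZStokesBox_proof` @ a749baa749a6. -/
theorem KZStokesBox_holds : KZStokesBox := _root_.Summit.KontsevichZagierPeriods.GaussManinCertificates.KZStokesBox_proof

/-- item stmt-KontsevichZagierPeriods-9889 · support · rank 9 · open · by planner
sources: Clausen1828, AndrewsAskeyRoy1999, KontsevichZagier2001
[support] The absolute form of ClausenQuarterModPi: r ~ r′ for every real algebraic x₀ ∈ (0,1) (two
lines from ClausenQuarterModPi and PiCancellation, Sketch.lean; also an instance of the summit, so a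
refutation refutes Conjecture 1 and decides card ramanujan-pi-series' claim that Clausen compiles
only through Shioda–Inose). [difficulty: XL] -/
@[route_item "route-KontsevichZagierPeriods-KatzTower"]
def ClausenQuarter : Prop :=
  ∀ x₀ : ℝ, IsAlgebraic ℚ x₀ → 0 < x₀ → x₀ < 1 → ∀ (r r' : Literature.NumberTheory.Transcendental.KZ.IntegralRep 2), r.domain = {x | ∀ i, x i ∈ Set.Ioo (0:ℝ) 1} → Set.EqOn r.integrand (fun x => ((x 0) ^ (-(3:ℝ)/4) * (1 - x 0) ^ (-(1:ℝ)/4) * (1 - x₀ * x 0) ^ (-(1:ℝ)/4)) * ((x 1) ^ (-(3:ℝ)/4) * (1 - x 1) ^ (-(1:ℝ)/4) * (1 - x₀ * x 1) ^ (-(1:ℝ)/4))) r.domain → r'.domain = {x | ∀ i, x i ∈ Set.Ioo (0:ℝ) 1} → Set.EqOn r'.integrand (fun x => 2 * (x 0 * x 1 * (1 - x 0) * (1 - x 1) * (1 - x₀ * x 0 * x 1)) ^ (-(1:ℝ)/2)) r'.domain → Literature.NumberTheory.Transcendental.KZ.Equivalent r r'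

-- earlier Assembly (stmt-KontsevichZagierPeriods-9890, replaced 2026-08-15T16:38:12Z -> stmt-KontsevichZagierPeriods-11054): retired by None — BetaWall → PiCancellation → BetaLocalKernel → KontsevichZagierPeriods
/-- item stmt-KontsevichZagierPeriods-11054 · assembly · rank 1 · closed · proved by Summit.KontsevichZagierPeriods.KatzTower.assembly_proof @ f04e676f536c (prover) · by planner
sources: KontsevichZagier2001, HuberMullerStach2017
[assembly] DiscPadding → BetaWall → PiCancellation → BetaLocalKernel → KontsevichZagierPeriods (=
the deciding theorem `closes`, rev 1). -/
@[route_item "route-KontsevichZagierPeriods-KatzTower"]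
def Assembly : Prop :=
  DiscPadding → BetaWall → PiCancellation → BetaLocalKernel → KontsevichZagierPeriods

-- `Assembly` holds: proved by `Summit.KontsevichZagierPeriods.KatzTower.assembly_proof` @ f04e676f536c (its module imports this route file, so no `_holds` link can be stated here).

/-! D-0027 §2.1 — DECIDING THEOREM (planner-authored via `route open/edit --closes-file`; by planner-rrepair-KontsevichZagierPeriods-KatzTo-2321a8aa-g2-0 2026-08-15T16:38:12Z):
its hypotheses are this route's items and its conclusion the sub-problem Statement (glue_lint), and it elaborates with this file. -/

@[closes "route-KontsevichZagierPeriods-KatzTower"] theorem closes : DiscPadding → BetaWall → PiCancellation → BetaLocalKernel → KontsevichZagierPeriods := by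
  rintro ⟨P, hPspec⟩ hW hP hK n m r r' _ _ hv
  have h0 : Literature.NumberTheory.Transcendental.KZ.eval
      (Literature.NumberTheory.Transcendental.KZ.of r - Literature.NumberTheory.Transcendental.KZ.of r') = 0 := by
    simp [Literature.NumberTheory.Transcendental.KZ.eval_of, hv]
  obtain ⟨N, hN⟩ := hK P hPspec _ h0
  have hN' : (⇑(FreeAbelianGroup.lift (fun s : (Σ n, Literature.NumberTheory.Transcendental.KZ.IntegralRep n) =>
      Literature.NumberTheory.Transcendental.KZ.of (P s.1 s.2))))^[N]
      (Literature.NumberTheory.Transcendental.KZ.of r - Literature.NumberTheory.Transcendental.KZ.of r')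
      ∈ Literature.NumberTheory.Transcendental.KZ.relations := by
    have hsub : ∀ (A B : AddSubgroup Literature.NumberTheory.Transcendental.KZ.FormalRep),
        B ≤ A → ∀ x, x ∈ A ⊔ B → x ∈ A := fun A B h x hx => (sup_le le_rfl h) hx
    refine hsub _ _ ?_ _ hN
    refine (AddSubgroup.closure_le _).mpr ?_
    rintro d ⟨k, l, β, β', C, C', p, q, p', q', hC, hC', h1, h2, h3, h4, h5, rfl⟩
    exact hW k l β β' C C' p q p' q' hC hC' h1 h2 h3 h4 h5
  have key : ∀ (M : ℕ) (c : Literature.NumberTheory.Transcendental.KZ.FormalRep),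
      (⇑(FreeAbelianGroup.lift (fun s : (Σ n, Literature.NumberTheory.Transcendental.KZ.IntegralRep n) =>
        Literature.NumberTheory.Transcendental.KZ.of (P s.1 s.2))))^[M] c
        ∈ Literature.NumberTheory.Transcendental.KZ.relations →
      c ∈ Literature.NumberTheory.Transcendental.KZ.relations := by
    intro M
    induction M with
    | zero => intro c h; simpa using h
    | succ M ih =>
        intro c h
        rw [Function.iterate_succ_apply'] at h
        exact ih c (hP P hPspec _ h)
  exact key N _ hN'

end Summit.KontsevichZagierPeriods.KontsevichZagierPeriods.Theses.KatzTower
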